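import Mathlib
import Literature.Analysis.FluidPDE.GaussianVortexPlanar
import Literature.Analysis.FluidPDE.GaussianVortexPlanarProofs
import Literature.Analysis.FluidPDE.BiotSavart2DSymmetry
import Summits.AnomalousDissipation.AnomalousDissipation.Theorems.MarginalStabilityChainStretchedVortexRowsStubCoreInverseTools
import Summits.AnomalousDissipation.AnomalousDissipation.Theorems.MarginalStabilityChainStretchedVortexRowsStubLogPotentialTools
import HarnessLib

/-!
# Helper `logPotential_even_circMean` toward stub `stub_coreInverse` of the line
# `braid-closed-large-circulation-gluing` (crux stmt-AnomalousDissipation-3009, `MarginalStabilityChain.StretchedVortexRows`)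

Symmetries of the logarithmic potential `ψ = N ∗ g`, `N = (2π)⁻¹ log ‖·‖`, of a continuous Gaussian-bounded density
on `ℝ² = EuclideanSpace ℝ (Fin 2)` (wave 3, toward `logPotential_neutral_energy`):

* `g` even ⇒ `ψ` even (substitution `η ↦ −η`);
* `g` with zero circular means ⇒ `ψ` with zero circular means: for the rotation `R_t z = cos t · z + sin t · z^⊥`
  (a linear isometry), `ψ(R_t ξ) = ∫ N(ξ − η) g(R_t η) dη`; integrating `t` over `[0, 2π]`, Fubini and the angle
  shift `R_t (r u(α)) = r u(t + α)` reduce the inner integral to a circular mean of `g`.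
-/

set_option linter.dupNamespace false
noncomputable section
open scoped RealInnerProductSpace Topology
open MeasureTheory WithLp Function Metric Filter Set

namespace Summit.AnomalousDissipation.AnomalousDissipation.Theorems.MarginalStabilityChainStretchedVortexRows

open Literature.Analysis.FluidPDE

/-! ### The rotations `R_t z = cos t · z + sin t · z^⊥` -/

/-- The circle point `(r cos θ, r sin θ)` is the rotation by `θ` of `(r, 0)`. [folklore] -/
theorem circlePoint_eq_rotation (r θ : ℝ) :
    (toLp 2 ![r * Real.cos θ, r * Real.sin θ] : EuclideanSpace ℝ (Fin 2)) =
      Real.cos θ • (toLp 2 ![r, 0] : EuclideanSpace ℝ (Fin 2)) + Real.sin θ • perp (toLp 2 ![r, 0]) := by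
  ext i
  fin_cases i <;> simp [perp, mul_comm]

/-- **Angle shift**: for `η ≠ 0` there is an angle `α` with `R_θ η = (‖η‖ cos(θ + α), ‖η‖ sin(θ + α))` for all `θ`.
[folklore] -/
theorem exists_angle_rotation_eq {η : EuclideanSpace ℝ (Fin 2)} (hη : η ≠ 0) :
    ∃ α : ℝ, ∀ θ : ℝ, Real.cos θ • η + Real.sin θ • perp η =
      (toLp 2 ![‖η‖ * Real.cos (θ + α), ‖η‖ * Real.sin (θ + α)] : EuclideanSpace ℝ (Fin 2)) := by
  set z : ℂ := ⟨η 0, η 1⟩ with hz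
  have hnorm : ‖z‖ = ‖η‖ := by
    rw [Complex.norm_def, Complex.normSq_mk, EuclideanSpace.norm_eq, Fin.sum_univ_two, Real.norm_eq_abs,
      Real.norm_eq_abs, sq_abs, sq_abs]
    congr 1
    ring
  have hz0 : z ≠ 0 := by
    intro h
    apply hη
    have h0 : η 0 = 0 := by simpa [hz] using congrArg Complex.re h
    have h1 : η 1 = 0 := by simpa [hz] using congrArg Complex.im h
    ext i
    fin_cases i
    · exact h0
    · exact h1
  have hn : ‖η‖ ≠ 0 := norm_ne_zero_iff.2 hη
  have hre : z.re = η 0 := rfl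
  have him : z.im = η 1 := rfl
  refine ⟨Complex.arg z, fun θ => ?_⟩
  have hc : ‖η‖ * Real.cos (Complex.arg z) = η 0 := by
    rw [Complex.cos_arg hz0, hnorm, hre]; field_simp
  have hs : ‖η‖ * Real.sin (Complex.arg z) = η 1 := by
    rw [Complex.sin_arg, hnorm, him]; field_simp
  ext i
  fin_cases i
  · simp [perp, Real.cos_add]
    linear_combination (-Real.cos θ) * hc + (Real.sin θ) * hs
  · simp [perp, Real.sin_add]
    linear_combination (-Real.cos θ) * hs - (Real.sin θ) * hc

/-- The circular mean of a function with zero circular means vanishes along every rotation orbit off the origin: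
`∫₀^{2π} g(R_θ η) dθ = 0` for `η ≠ 0`. [folklore] -/
theorem intervalIntegral_rotation_eq_zero {g : EuclideanSpace ℝ (Fin 2) → ℝ}
    (hcirc : ∀ r, 0 < r → ∫ θ in (0:ℝ)..(2 * Real.pi), g (toLp 2 ![r * Real.cos θ, r * Real.sin θ]) = 0)
    {η : EuclideanSpace ℝ (Fin 2)} (hη : η ≠ 0) :
    ∫ θ in (0:ℝ)..(2 * Real.pi), g (Real.cos θ • η + Real.sin θ • perp η) = 0 := by
  obtain ⟨α, hα⟩ := exists_angle_rotation_eq hη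
  simp_rw [hα]
  have hper : Function.Periodic (fun s : ℝ =>
      g (toLp 2 ![‖η‖ * Real.cos s, ‖η‖ * Real.sin s] : EuclideanSpace ℝ (Fin 2))) (2 * Real.pi) := fun s => by
    simp only [Real.cos_add_two_pi, Real.sin_add_two_pi]
  rw [intervalIntegral.integral_comp_add_right (fun s : ℝ =>
      g (toLp 2 ![‖η‖ * Real.cos s, ‖η‖ * Real.sin s] : EuclideanSpace ℝ (Fin 2))) α, zero_add,
    show 2 * Real.pi + α = α + 2 * Real.pi by ring, hper.intervalIntegral_add_eq α 0, zero_add]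
  exact hcirc ‖η‖ (norm_pos_iff.2 hη)

/-! ### Evenness and circular means of the potential -/

section Sym

variable {B : ℝ} {g : EuclideanSpace ℝ (Fin 2) → ℝ} (hgc : Continuous g)
  (hg0 : ∀ η, |g η| ≤ B * Real.exp (-(1 / 8) * ‖η‖ ^ 2))

/-- **Evenness**: `g` even ⇒ `ψ(−ξ) = ψ(ξ)` (substitute `η ↦ −η`). [folklore] -/
theorem logPotential_neg (heven : ∀ η, g (-η) = g η) (ξ : EuclideanSpace ℝ (Fin 2)) :
    ∫ η, (2 * Real.pi)⁻¹ * Real.log ‖-ξ - η‖ * g η = ∫ η, (2 * Real.pi)⁻¹ * Real.log ‖ξ - η‖ * g η := by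
  calc ∫ η, (2 * Real.pi)⁻¹ * Real.log ‖-ξ - η‖ * g η
      = ∫ η, (2 * Real.pi)⁻¹ * Real.log ‖-ξ - -η‖ * g (-η) :=
        (integral_neg_eq_self (fun η => (2 * Real.pi)⁻¹ * Real.log ‖-ξ - η‖ * g η) volume).symm
    _ = ∫ η, (2 * Real.pi)⁻¹ * Real.log ‖ξ - η‖ * g η := by
        refine integral_congr_ae (Eventually.of_forall fun η => ?_)
        simp only [heven, sub_neg_eq_add, neg_add_eq_sub, norm_sub_rev η ξ]

include hg0 in
/-- `|N(ξ − η)| e^{−‖η‖²/8}` is integrable in `η`. [folklore] -/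
theorem integrable_abs_logKernel_mul_exp (ξ : EuclideanSpace ℝ (Fin 2)) :
    Integrable fun η : EuclideanSpace ℝ (Fin 2) =>
      |(2 * Real.pi)⁻¹ * Real.log ‖ξ - η‖| * (B * Real.exp (-(1 / 8) * ‖η‖ ^ 2)) := by
  have hB : 0 ≤ B := (abs_nonneg _).trans ((hg0 0).trans (le_of_eq (by simp)))
  have hi0 : Integrable fun η : EuclideanSpace ℝ (Fin 2) =>
      (ball (0 : EuclideanSpace ℝ (Fin 2)) 1).indicator (fun z => -Real.log ‖z‖) (ξ - η) :=
    integrable_indicator_neg_log_norm.comp_sub_left ξ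
  have hi1 := integrable_one_add_norm_pow_mul_exp_eighth 1
  have hmeas : AEStronglyMeasurable (fun η : EuclideanSpace ℝ (Fin 2) =>
      |(2 * Real.pi)⁻¹ * Real.log ‖ξ - η‖| * (B * Real.exp (-(1 / 8) * ‖η‖ ^ 2))) volume :=
    (((measurable_const.mul ((measurable_const.sub measurable_id).norm.log)).abs).mul
      (by fun_prop)).aestronglyMeasurable
  refine (((hi0.add (hi1.const_mul (Real.log (1 + ‖ξ‖) + 1))).const_mul ((2 * Real.pi)⁻¹ * B))).mono' hmeas
    (Eventually.of_forall fun η => ?_)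
  rw [Real.norm_of_nonneg (by positivity), abs_mul, abs_of_pos (by positivity : (0:ℝ) < (2 * Real.pi)⁻¹),
    Pi.add_apply]
  have h1 := abs_log_norm_sub_le ξ η
  have h4 := indicator_neg_log_norm_nonneg (ξ - η)
  have he : Real.exp (-(1 / 8) * ‖η‖ ^ 2) ≤ 1 := Real.exp_le_one_iff.2 (by nlinarith [norm_nonneg η])
  have he0 : 0 ≤ Real.exp (-(1 / 8) * ‖η‖ ^ 2) := (Real.exp_pos _).le
  have hL : 0 ≤ Real.log (1 + ‖ξ‖) := Real.log_nonneg (by linarith [norm_nonneg ξ])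
  set L0 := (ball (0 : EuclideanSpace ℝ (Fin 2)) 1).indicator (fun z => -Real.log ‖z‖) (ξ - η)
  set e := Real.exp (-(1 / 8) * ‖η‖ ^ 2)
  have i1 : L0 * e ≤ L0 := mul_le_of_le_one_right h4 he
  have i2 : (Real.log (1 + ‖ξ‖) + ‖η‖) * e ≤ (Real.log (1 + ‖ξ‖) + 1) * ((1 + ‖η‖) ^ 1 * e) := by
    rw [pow_one]
    have h := mul_nonneg (add_nonneg (mul_nonneg hL (norm_nonneg η)) zero_le_one) he0
    nlinarith [h]
  calc (2 * Real.pi)⁻¹ * |Real.log ‖ξ - η‖| * (B * e)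
      ≤ (2 * Real.pi)⁻¹ * (L0 + Real.log (1 + ‖ξ‖) + ‖η‖) * (B * e) := by gcongr
    _ = (2 * Real.pi)⁻¹ * B * (L0 * e + (Real.log (1 + ‖ξ‖) + ‖η‖) * e) := by ring
    _ ≤ (2 * Real.pi)⁻¹ * B * (L0 + (Real.log (1 + ‖ξ‖) + 1) * ((1 + ‖η‖) ^ 1 * e)) := by
        gcongr

include hgc hg0 in
/-- **Zero circular means**: if `g` has zero circular means then so has `ψ = N ∗ g` (on every circle, including
`r ≤ 0` by the symmetry of the statement). [folklore] -/
theorem logPotential_circMean_eq_zero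
    (hcirc : ∀ r, 0 < r → ∫ θ in (0:ℝ)..(2 * Real.pi), g (toLp 2 ![r * Real.cos θ, r * Real.sin θ]) = 0)
    (r : ℝ) :
    ∫ θ in (0:ℝ)..(2 * Real.pi), (∫ η, (2 * Real.pi)⁻¹ *
      Real.log ‖(toLp 2 ![r * Real.cos θ, r * Real.sin θ] : EuclideanSpace ℝ (Fin 2)) - η‖ * g η) = 0 := by
  have hB : 0 ≤ B := (abs_nonneg _).trans ((hg0 0).trans (le_of_eq (by simp)))
  have h2π : (0:ℝ) ≤ 2 * Real.pi := by positivity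
  obtain ⟨ξ₀, hξ₀⟩ : ∃ x : EuclideanSpace ℝ (Fin 2), x = toLp 2 ![r, 0] := ⟨_, rfl⟩
  -- Step 1: rotate the variable of integration
  have hstep : ∀ θ : ℝ, (∫ η, (2 * Real.pi)⁻¹ * Real.log ‖(Real.cos θ • ξ₀ + Real.sin θ • perp ξ₀) - η‖ * g η) =
      ∫ η, (2 * Real.pi)⁻¹ * Real.log ‖ξ₀ - η‖ * g (Real.cos θ • η + Real.sin θ • perp η) := by
    intro θ
    obtain ⟨R, hR⟩ := exists_planarRotation (Real.cos θ) (Real.sin θ) (Real.cos_sq_add_sin_sq θ)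
    have h1 : ∫ η, (2 * Real.pi)⁻¹ * Real.log ‖R ξ₀ - R η‖ * g (R η) =
        ∫ η, (2 * Real.pi)⁻¹ * Real.log ‖R ξ₀ - η‖ * g η :=
      R.measurePreserving.integral_comp R.toHomeomorph.measurableEmbedding
        (fun η => (2 * Real.pi)⁻¹ * Real.log ‖R ξ₀ - η‖ * g η)
    rw [← hR ξ₀, ← h1]
    refine integral_congr_ae (Eventually.of_forall fun η => ?_)
    beta_reduce
    rw [← map_sub, LinearIsometryEquiv.norm_map, hR η]
  simp_rw [circlePoint_eq_rotation, ← hξ₀, hstep]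
  -- Step 2: Fubini on `[0, 2π] × ℝ²`
  set F : ℝ → EuclideanSpace ℝ (Fin 2) → ℝ := fun θ η =>
    (2 * Real.pi)⁻¹ * Real.log ‖ξ₀ - η‖ * g (Real.cos θ • η + Real.sin θ • perp η) with hF
  have hrotc : Continuous fun p : ℝ × EuclideanSpace ℝ (Fin 2) => Real.cos p.1 • p.2 + Real.sin p.1 • perp p.2 :=
    ((Real.continuous_cos.comp continuous_fst).smul continuous_snd).add
      ((Real.continuous_sin.comp continuous_fst).smul (continuous_perp.comp continuous_snd))
  have hFmeas : Measurable (uncurry F) :=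
    ((measurable_const.mul ((measurable_const.sub measurable_snd).norm.log)).mul
      (hgc.measurable.comp hrotc.measurable))
  have hFm : AEStronglyMeasurable (uncurry F)
      ((volume.restrict (Ioc (0:ℝ) (2 * Real.pi))).prod (volume : Measure (EuclideanSpace ℝ (Fin 2)))) :=
    hFmeas.aestronglyMeasurable
  have hFb : ∀ θ η, ‖F θ η‖ ≤ |(2 * Real.pi)⁻¹ * Real.log ‖ξ₀ - η‖| * (B * Real.exp (-(1 / 8) * ‖η‖ ^ 2)) := by
    intro θ η
    simp only [hF, norm_mul, Real.norm_eq_abs]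
    rw [← abs_mul]
    refine mul_le_mul_of_nonneg_left ?_ (abs_nonneg _)
    have := hg0 (Real.cos θ • η + Real.sin θ • perp η)
    rwa [norm_cos_smul_add_sin_smul_perp] at this
  have hb := integrable_abs_logKernel_mul_exp hg0 ξ₀
  have hInt : Integrable (uncurry F)
      ((volume.restrict (Ioc (0:ℝ) (2 * Real.pi))).prod (volume : Measure (EuclideanSpace ℝ (Fin 2)))) := by
    rw [integrable_prod_iff hFm]
    refine ⟨Eventually.of_forall fun θ => hb.mono'
      (hFmeas.comp (measurable_const.prodMk measurable_id)).aestronglyMeasurable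
      (Eventually.of_forall (hFb θ)), ?_⟩
    refine (integrable_const (∫ η, |(2 * Real.pi)⁻¹ * Real.log ‖ξ₀ - η‖| *
      (B * Real.exp (-(1 / 8) * ‖η‖ ^ 2)))).mono' hFm.norm.integral_prod_right' (Eventually.of_forall fun θ => ?_)
    rw [Real.norm_of_nonneg (integral_nonneg fun η => norm_nonneg _)]
    exact integral_mono (hb.mono' (hFmeas.comp (measurable_const.prodMk measurable_id)).aestronglyMeasurable.norm
      (Eventually.of_forall fun η => by rw [norm_norm]; exact hFb θ η)) hb (hFb θ)
  rw [intervalIntegral.integral_of_le h2π, integral_integral_swap hInt]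
  -- Step 3: the inner angular integral vanishes off the origin
  refine integral_eq_zero_of_ae ?_
  have hae : ∀ᵐ η ∂(volume : Measure (EuclideanSpace ℝ (Fin 2))), η ≠ 0 := by
    rw [ae_iff]; simp
  filter_upwards [hae] with η hη
  simp only [hF, Pi.zero_apply]
  rw [integral_const_mul, ← intervalIntegral.integral_of_le h2π, intervalIntegral_rotation_eq_zero hcirc hη,
    mul_zero]

end Sym

/-! ### The registered helper -/

/-- **Evenness and zero circular means of the logarithmic potential** `ψ = N ∗ g` (`N = (2π)⁻¹ log ‖·‖`) of a
continuous Gaussian-bounded density that is even with zero circular means (registered helper toward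
`logPotential_neutral_energy` / `stub_coreInverse`). [folklore] -/
theorem logPotential_even_circMean :
    ∀ (B : ℝ) (g : EuclideanSpace ℝ (Fin 2) → ℝ), Continuous g →
      (∀ η, |g η| ≤ B * Real.exp (-(1 / 8) * ‖η‖ ^ 2)) → (∀ η, g (-η) = g η) →
      (∀ r, 0 < r → ∫ θ in (0:ℝ)..(2 * Real.pi), g (toLp 2 ![r * Real.cos θ, r * Real.sin θ]) = 0) →
      (∀ ξ : EuclideanSpace ℝ (Fin 2), (∫ η, (2 * Real.pi)⁻¹ * Real.log ‖-ξ - η‖ * g η) =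
          ∫ η, (2 * Real.pi)⁻¹ * Real.log ‖ξ - η‖ * g η) ∧
        ∀ r, 0 < r → ∫ θ in (0:ℝ)..(2 * Real.pi), (∫ η, (2 * Real.pi)⁻¹ *
          Real.log ‖(toLp 2 ![r * Real.cos θ, r * Real.sin θ] : EuclideanSpace ℝ (Fin 2)) - η‖ * g η) = 0 :=
  fun _ _ hgc hg0 heven hcirc =>
    ⟨fun ξ => logPotential_neg heven ξ, fun r _ => logPotential_circMean_eq_zero hgc hg0 hcirc r⟩

end Summit.AnomalousDissipation.AnomalousDissipation.Theorems.MarginalStabilityChainStretchedVortexRows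

end
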